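import Summits.QuantumFields.YangMills.Theorems.ColdStartUniversalityLatticeLangevinHypercontractiveConcentration
import Summits.QuantumFields.YangMills.Theorems.ColdStartUniversalityLatticeLangevinWilsonLoopConcentration
import Literature.MathematicalPhysics.QuantumFieldTheory.CentralCircleDominatedWilsonLoops
import HarnessLib

/-!
# Route `ColdStartUniversality` (fixed-cut-off package, `Lᵖ` side): ★★★ SPATIALLY AVERAGED WILSON LOOPS FROM ONE CONFIGURATION of the
# cold-start simulation after `O(log L)` sweeps, `|β'| < 1/12` — volume-free Gaussian concentration of a single sample

Helper file (seat `ym-line-csu-p1`, g36; `--supports stmt-QuantumFields-24809`).  g27's volume-uniform concentration of the spatially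
averaged `R × T` Wilson loop `W̄ = (L³)⁻¹Σ_x W_{γ+x}` under `μ_{β'}` (`wilson_loopAverage_concentration_uniform`:
`μ{|W̄ − ⟨W̄⟩| ≥ r} ≤ 2·exp(−(1−12|β'|)·L³·r²/(96(R+T)²))`) combined with the events form of the `L²`-warm start after the hypercontractive
burn-in (`measureReal_map_le_exp_mul_sqrt_uniform`, g36: `P(U_{2+t₀+u} ∈ A) ≤ e·μ(A)^{1/2}` when `log B ≤ 2(1−12|β'|)t₀`):
* ★★★ `coldStart_loopAverage_concentration_uniform` — for every `L`, `|β'| < 1/12`, `i, j`, `R + T > 0`, every deterministic start, EVERY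
  strong solution, all `t₀, u ≥ 0` with `log B ≤ 2(1−12|β'|)t₀` and every `r ≥ 0`:
  `P[ |W̄(U_{2+t₀+u}) − ∫ W̄ dμ_{β'}| ≥ r ] ≤ e·√2·exp(−(1 − 12|β'|)·#sites·r²/(192(R+T)²))`  (`#sites = L³`).
Reading: the inputs of a CREUTZ RATIO measured on ONE configuration `O(log L)` lattice units after a cold start are within `x(R+T)L^{-3/2}` of
their Gibbs values except with probability `e√2·e^{−(1−12|β'|)x²/192}`, uniformly in the volume and in the loop's position.

THEOREMS ONLY, no definition, no sorry.  HONEST FRAMING: RECORD-rung R3 plumbing at FIXED cut-off in LATTICE units, high-temperature window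
`|β'| < 1/12` (no area law / string tension statement); nothing K-uniform; no crux, rung or summit statement is proved; the Yang–Mills mass gap is
NOT proved.
-/

set_option autoImplicit false

noncomputable section

namespace Summit.QuantumFields.YangMills.Theorems.ColdStartUniversality

open MeasureTheory ProbabilityTheory Filter Set Topology
open scoped BigOperators NNReal ENNReal
open Literature.Probability.Process Literature.MathematicalPhysics.QuantumFieldTheory
open Literature.MathematicalPhysics.QuantumLattice (fundamentalRep fundamentalLatticeRep continuous_fundamentalRep)

variable {L : ℕ} [NeZero L]

/-- ★★★ **Gaussian concentration of the spatially averaged Wilson loop of ONE sample after the burn-in.**  For every `L`, `|β'| < 1/12`,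
directions `i, j`, sizes `R, T` with `R + T > 0`, every deterministic start `z`, EVERY strong solution `U` from `z`, all `t₀, u ≥ 0` with
`log B ≤ 2(1 − 12|β'|)t₀` and every `r ≥ 0`:
`P[ r ≤ |(#sites)⁻¹Σ_x W_{x,i,j,R,T}(U_{2+t₀+u}) − ∫ (#sites)⁻¹Σ_x W_{x,i,j,R,T} dμ_{β'}| ] ≤ e·√2·exp(−(1 − 12|β'|)·#sites·r²/(192(R+T)²))`.
[cite: ShenZhuZhu2022, §4 Theorem 4.2, Corollary 4.4] [cite: DiaconisSaloffcoste1996, Theorem 3.7] -/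
theorem coldStart_loopAverage_concentration_uniform (L : ℕ) [NeZero L] (β' : ℝ) (hβ : |β'| < 1 / 12) (i j : Fin 3) (R T : ℕ)
    (hRT : 0 < R + T) (z : GaugeConfig 3 L (Matrix.specialUnitaryGroup (Fin 2) ℂ))
    {Ω : Type} [MeasurableSpace Ω] {P : Measure Ω} [IsProbabilityMeasure P]
    {W : ℝ≥0 → Ω → (Edge 3 L × NoiseIdx 2 → ℝ)} (hW : IsFlatBrownian W P)
    {U : ℝ≥0 → Ω → GaugeConfig 3 L (Matrix.specialUnitaryGroup (Fin 2) ℂ)} (hU0 : ∀ ω, U 0 ω = z)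
    (hU : (latticeLangevinDynamics (fundamentalLatticeRep 2) β').IsSolution (fundamentalRep (Fin 2)) hW.natFiltration P W U)
    (t₀ u : ℝ≥0)
    (ht₀ : Real.log (96 * |β'| * (Fintype.card (Edge 3 L) : ℝ) + 10 * |β'| * (Fintype.card (Plaquette 3 L) : ℝ) + Real.log 2 +
      (Fintype.card (Edge 3 L) : ℝ) * Real.log (3 / 2)) ≤ 2 * (1 - 12 * |β'|) * t₀)
    {r : ℝ} (hr : 0 ≤ r) :
    P.real {ω | r ≤ |(((Fintype.card (Site 3 L) : ℝ))⁻¹ * ∑ x : Site 3 L, wilsonLoop (fundamentalRep (Fin 2)) x i j R T (U (2 + t₀ + u) ω)) -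
        ∫ V', (((Fintype.card (Site 3 L) : ℝ))⁻¹ * ∑ x : Site 3 L, wilsonLoop (fundamentalRep (Fin 2)) x i j R T V')
          ∂(wilsonMeasure (d := 3) (L := L) (fundamentalRep (Fin 2)) β')|} ≤
      Real.exp 1 * Real.sqrt 2 *
        Real.exp (-((1 - 12 * |β'|) * (Fintype.card (Site 3 L) : ℝ) * r ^ 2 / (192 * ((R : ℝ) + T) ^ 2))) := by
  classical
  haveI := secondCountableTopology_su2
  haveI := borelSpace_config L
  haveI : IsProbabilityMeasure (wilsonMeasure (d := 3) (L := L) (fundamentalRep (Fin 2)) β') :=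
    isProbabilityMeasure_wilsonMeasure (d := 3) (L := L) (fundamentalRep (Fin 2)) (continuous_fundamentalRep (Fin 2)) β'
  set Wbar : GaugeConfig 3 L (Matrix.specialUnitaryGroup (Fin 2) ℂ) → ℝ := fun V =>
    (((Fintype.card (Site 3 L) : ℝ))⁻¹ * ∑ x : Site 3 L, wilsonLoop (fundamentalRep (Fin 2)) x i j R T V) with hWbar
  have hWc : Continuous Wbar :=
    continuous_const.mul (continuous_finsetSum _ fun x _ =>
      continuous_wilsonLoop (fundamentalRep (Fin 2)) (continuous_fundamentalRep (Fin 2)) x i j R T)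
  set m : ℝ := ∫ V', Wbar V' ∂(wilsonMeasure (d := 3) (L := L) (fundamentalRep (Fin 2)) β') with hm
  set A : Set (GaugeConfig 3 L (Matrix.specialUnitaryGroup (Fin 2) ℂ)) := {V | r ≤ |Wbar V - m|} with hAdef
  have hA : MeasurableSet A := measurableSet_le measurable_const ((hWc.sub continuous_const).abs).measurable
  have hmU : Measurable (U (2 + t₀ + u)) := (hU.adapted _).mono (hW.natFiltration.le _) le_rfl
  have hev : P.real {ω | r ≤ |(((Fintype.card (Site 3 L) : ℝ))⁻¹ * ∑ x : Site 3 L, wilsonLoop (fundamentalRep (Fin 2)) x i j R T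
      (U (2 + t₀ + u) ω)) - m|} = (P.map (U (2 + t₀ + u))).real A := by
    rw [measureReal_def, measureReal_def, Measure.map_apply hmU hA]; rfl
  rw [hev]
  have h1 := measureReal_map_le_exp_mul_sqrt_uniform L β' hβ z hW hU0 hU hA t₀ u ht₀
  have h2 : (wilsonMeasure (d := 3) (L := L) (fundamentalRep (Fin 2)) β').real A ≤
      2 * Real.exp (-((1 - 12 * |β'|) * (Fintype.card (Site 3 L) : ℝ) * r ^ 2 / (96 * ((R : ℝ) + T) ^ 2))) :=
    wilson_loopAverage_concentration_uniform L β' hβ i j R T hRT r hr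
  have h3 : ((wilsonMeasure (d := 3) (L := L) (fundamentalRep (Fin 2)) β').real A) ^ (1 / (2 : ℝ)) ≤
      Real.sqrt 2 * Real.exp (-((1 - 12 * |β'|) * (Fintype.card (Site 3 L) : ℝ) * r ^ 2 / (192 * ((R : ℝ) + T) ^ 2))) := by
    have h := Real.rpow_le_rpow measureReal_nonneg h2 (by norm_num : (0 : ℝ) ≤ 1 / 2)
    have e : (2 * Real.exp (-((1 - 12 * |β'|) * (Fintype.card (Site 3 L) : ℝ) * r ^ 2 / (96 * ((R : ℝ) + T) ^ 2)))) ^ (1 / (2 : ℝ)) =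
        Real.sqrt 2 * Real.exp (-((1 - 12 * |β'|) * (Fintype.card (Site 3 L) : ℝ) * r ^ 2 / (192 * ((R : ℝ) + T) ^ 2))) := by
      have hRT0 : ((R : ℝ) + T) ^ 2 ≠ 0 := by
        have : (0 : ℝ) < (R : ℝ) + T := by exact_mod_cast hRT
        positivity
      rw [Real.mul_rpow (by norm_num) (Real.exp_pos _).le, Real.sqrt_eq_rpow, ← Real.exp_mul]
      congr 2
      field_simp
      ring
    rw [e] at h; exact h
  calc _ ≤ _ := h1
    _ ≤ Real.exp 1 * (Real.sqrt 2 *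
          Real.exp (-((1 - 12 * |β'|) * (Fintype.card (Site 3 L) : ℝ) * r ^ 2 / (192 * ((R : ℝ) + T) ^ 2)))) :=
        mul_le_mul_of_nonneg_left h3 (Real.exp_pos 1).le
    _ = _ := by ring

end Summit.QuantumFields.YangMills.Theorems.ColdStartUniversality

end
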